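import Mathlib
import HarnessLib
import Summits.ValiantsHypothesis.ValiantsHypothesis.Theses.MonotoneRestoration
import Literature.Computability.AlgebraicComplexity.ArithCircuit
import Literature.Computability.AlgebraicComplexity.ArithCircuitProofs
import Literature.Computability.AlgebraicComplexity.MonotoneStructure
import Literature.Computability.AlgebraicComplexity.PermanentIrreducible
import Literature.ModelTheory.FiniteModelTheory.CkEquiv
import Summits.ValiantsHypothesis.ValiantsHypothesis.Theorems.MonotoneRestorationMonotoneRestorationQPCosetCount
import Summits.ValiantsHypothesis.ValiantsHypothesis.Theorems.MonotoneRestorationMonotoneRestorationQPSymmetricLB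
import Summits.ValiantsHypothesis.ValiantsHypothesis.Theorems.MonotoneRestorationMonotoneRestorationQPSupportSymmetrisation
import Summits.ValiantsHypothesis.ValiantsHypothesis.Theorems.MonotoneRestorationMonotoneRestorationQPSparseRegime
import Summits.ValiantsHypothesis.ValiantsHypothesis.Theorems.MonotoneRestorationMonotoneRestorationQPBeta
import Literature.Computability.AlgebraicComplexity.SymmetricArithCircuit
import Literature.Computability.AlgebraicComplexity.DawarWilsenach2025Proofs
import Literature.GroupTheory.PermutationGroups.SmallIndexSubgroups
import Summits.ValiantsHypothesis.ValiantsHypothesis.Theorems.MonotoneRestorationQP.Negative.LoadBearing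
import Summits.ValiantsHypothesis.ValiantsHypothesis.Theorems.MonotoneRestorationMonotoneRestorationQPPermSupportCount

/-! TTRL-lite variant V21344 of stmt-ValiantsHypothesis-15886 -/

/-!
The last step of the registered proof of `stub_symmetricMonotone_choose_le_card`, stated for an
arbitrary polynomial: a nonzero homogeneous row-multilinear `f` of degree `d` has a monomial
touching a row outside any row set `X` with `|X| < d` (pick `m ∈ supp f`; if all rows of `m`
were in `X`, row-multilinearity would give `deg m ≤ |X| < d = deg m`).
-/

-- `Summit.ValiantsHypothesis.ValiantsHypothesis.…` is the tree's mandated single-conjunct layout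
-- (Sub = Summit), so the duplicated namespace component is intended.
set_option linter.dupNamespace false

namespace Summit.ValiantsHypothesis.ValiantsHypothesis.Theorems

open Summit.ValiantsHypothesis.ValiantsHypothesis.Theses.MonotoneRestoration
open Literature.Computability.AlgebraicComplexity

/-- TTRL-lite variant V21344 of `stub_symmetricMonotone_choose_le_card`
(`stmt-ValiantsHypothesis-15886`): a nonzero homogeneous row-multilinear polynomial `f` of
degree `d` in the doubly indexed variables `x_{i,j}` has, for every row set `X` with `|X| < d`,
a monomial with a nonzero row degree at some row outside `X`. [folklore] -/
theorem stub_symmetricMonotone_choose_le_card_var21344 :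
    ∀ (n d : ℕ) (f : MvPolynomial (Fin n × Fin n) NNReal) (X : Finset (Fin n)),
      f.IsHomogeneous d → f ≠ 0 → (∀ m ∈ f.support, ∀ i : Fin n, rowDegrees m i ≤ 1) →
      X.card < d → ∃ m ∈ f.support, ∃ i ∉ X, rowDegrees m i ≠ 0 := by
  intro n d f X hhom h0 hrow hX
  obtain ⟨m, hm⟩ := MvPolynomial.support_nonempty.2 h0
  refine ⟨m, hm, ?_⟩
  by_contra hcon
  push Not at hcon
  -- `m` has degree `d`
  have hdeg : m.degree = d := by
    rw [Finsupp.degree_apply]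
    exact (hhom.degree_eq_sum_deg_support hm).symm
  -- but all rows of `m` lie in `X` and have degree `≤ 1`, so `deg m ≤ |X|`
  have hle : m.degree ≤ X.card := by
    rw [← degree_rowDegrees, Finsupp.degree_apply]
    calc ∑ i ∈ (rowDegrees m).support, rowDegrees m i
        ≤ ∑ i ∈ (rowDegrees m).support, 1 := Finset.sum_le_sum fun i _ => hrow m hm i
      _ = (rowDegrees m).support.card := by simp
      _ ≤ X.card := Finset.card_le_card fun i hi => by
          by_contra hiX
          exact (Finsupp.mem_support_iff.1 hi) (hcon i hiX)
  omega

end Summit.ValiantsHypothesis.ValiantsHypothesis.Theorems
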